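import Summits.AtomisticToContinuum.Crystallization.Theses.NashClassCertificates
import Summits.AtomisticToContinuum.Crystallization.Theorems.CoerciveTwoShellGap.Negative.Tolerance
import Summits.AtomisticToContinuum.Crystallization.Theorems.NashClassCertificatesNashTwoShellGapNashSeparation
import Summits.AtomisticToContinuum.Crystallization.Theorems.HullMinimalityLayeredWindowsGroundStatesAreNash
import Literature.MathematicalPhysics.StatisticalMechanics.LennardJonesThermodynamicLimitProofs

/-!
# Disproof of `NashTwoShellGap` (stmt-AtomisticToContinuum-16826) — findings of the crux disprover

Crux (route `NashClassCertificates`, rank 2; line `birth` picked by the lead):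

  `∃ g > 0, ∀ N (x : Fin N → ℝ³), x 1/3-separated → x NASH for V_LJ →`
  `N·e* + g·#{i : ¬ IsTwoShellGood (1/20) (47/50) 1 x i} ≤ 𝓔_LJ(x)`,   `e* = ⨅_Q e_LJ(Q)`,

NASH = best response: `∀ i, ∀ y ∉ {x j : j ≠ i}, siteEnergy x i ≤ ∑_{j ≠ i} V_LJ(|y − x_j|)` (site sums
single-counted in full, `siteEnergy = ∑_{k ≠ i} V`, consistent with the clause).

**VERDICT (cycle 1): NO KILL.**  The statement as typed is sane: no junk value is reached (`V_LJ(0) = 0`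
is excluded by separation and by the guard `y ≠ x j`; `e*` is a genuine infimum, `= lim E(N)/N`, tree);
the hypotheses have non-trivial models (every all-unit-distance cluster, every LJ ground state); the
`g = 0` skeleton is free.  Every cheap physical attack pays a positive price per bad particle, and every
certified attack is blocked by the absence of a lower bound on `e*` sharper than stability constants:
a violator is a near-minimiser (`violation_squeeze`), and the only `e*`-free refutation road is a bad
FRACTION in the ground states themselves (§3), i.e. failure of two-shell crystallization — which nobody
can exhibit.  The Nash restriction removes every recorded witness against the parent cruxes
(pile-ups need coincidence; generic perturbations, rattlers, strained crystals are not force-balanced;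
vacancies/adatoms violate Aufbau), so this crux is at least as hard to refute as 13956.

## Index of findings (all theorems below are sorry-free unless marked NEAR-MISS; axioms standard)

* §0 READ-BACK: `nashTwoShellGap_iff` (defeq with `eStar`); `nashGap_zero` (skeleton free).
* §1 NON-VACUITY + CERTIFIED TIGHTNESS: `nash_of_forall_dist_eq_one`; `exists_unit_tetrahedron`;
  `g_le_of_nashGap` (`g ≤ −1/8 − e*`), `g_le_neg_eStar_of_nashGap`; `eStar_le_neg_one_eighth`;
  `eStar_lt_of_nashTwoShellGap`.  CERTIFIED REACH OF A REFUTATION: `neg_stability_le_eStar`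
  (`e* ≥ −2³²/12`, the tree's only lower bound) ⇒ `not_nashGap_of_huge`: prices `g > 2³²/12 − 1/8` are
  refuted, nothing below — the numerical gulf (believed `g_opt ≈ 4·10⁻³`) is the whole difficulty.
* §2 SEPARATION = INJECTIVITY: `third_le_dist_of_nash`, `nashTwoShellGap_iff_injectiveForm`,
  `isGroundState_mem_class`.
* §3 KILL TEMPLATE: `false_of_linear_charge_on_groundStates`, `not_nashTwoShellGap_of_groundStates_bad`,
  `bad_lt_of_nashTwoShellGap` (crux ⇒ `#bad = o(N)` on ground states), `not_tol_of_neg`, `tol_mono`.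
  OPEN on the Nash class: the `ε = 0` instance (refuted for 13956 by generic perturbation, which leaves
  the Nash class).
* §4 LINE `birth`: `exposedBadGap_of_nashTwoShellGap` (+ landed `jammedBadGap_of_nashTwoShellGap`,
  `stub_nashSeparation`, `stub_jammedOfTorusGap`): the line is a partition of the crux; no stub is
  refutable short of the crux; `stub_nashForceBalance` is true (Fermat).  Targets list: empty.
* §5 NEAR-MISS (the one `sorry` of this file): `nashTwoShellGap_false_without_injective` — with the
  separation/injectivity hypothesis dropped the statement is false through the junk value `V_LJ(0)=0`:
  WITNESS the junk-Nash pile cluster (centre pile of `3m` coincident particles + `m` coincident particles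
  at each of the `12` cuboctahedron vertices at distance `1`; `N = 15m`, `𝓔 ≤ −3m²` since the `36m²`
  centre–vertex pairs sit at the minimum and every other pair has `V ≤ 0`).  Its Nash property is a
  global inequality over `y ∈ ℝ³` per particle class, certified only NUMERICALLY (interval branch and
  bound in floating point, kit job j026014: certified, margins `≥ 0.1·m`, see the docstring) — a Lean certificate needs a
  verified interval evaluator (`native_decide` scale), not attempted: the finding is a junk-model effect
  (provers: keep injectivity; it is all `h_sep` gives you, §2).
* §6 NUMERICS LEDGER (uncertified; provers' calibration of `g`): see the docstring of §6.

Provers: cite freely; §§0–4 are LANDED verbatim (namespace `…Theorems.NashTwoShellGapNegative`) as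
`Theorems/NashTwoShellGap/Negative/Shape.lean` — p160677 ACCEPTED; §1bis (`neg_stability_le_eStar`,
`not_nashGap_of_huge`, `violation_squeeze`, `not_nashTwoShellGap_iff`) proposed as `…/Negative/Reach.lean`.
-/

noncomputable section

namespace Summit.AtomisticToContinuum.Crystallization.Cruxes.NashTwoShellGap.Disproof

open scoped BigOperators Classical
open Literature.MathematicalPhysics.StatisticalMechanics Literature.Geometry.DiscreteGeometry
open Summit.AtomisticToContinuum.Crystallization.Theorems.ChargedEnergyGapNegative
open Summit.AtomisticToContinuum.Crystallization.Theorems.CoerciveTwoShellGapNegative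
open Summit.AtomisticToContinuum.Crystallization.Theorems.NashTwoShellGapNashSeparation
open Summit.AtomisticToContinuum.Crystallization.Theorems.LayeredWindowsLocal
open Summit.AtomisticToContinuum.Crystallization.Theses.NashClassCertificates

/-! ## §0 Read-back -/

/-- The crux, definitionally, with the tree's abbreviation `eStar = ⨅_Q e_LJ(Q)`. [folklore] -/
theorem nashTwoShellGap_iff :
    NashTwoShellGap ↔ ∃ g : ℝ, 0 < g ∧ ∀ (N : ℕ) (x : Fin N → E3),
      (∀ i j : Fin N, i ≠ j → (1 / 3 : ℝ) ≤ dist (x i) (x j)) →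
      (∀ (i : Fin N) (y : E3), (∀ j : Fin N, j ≠ i → y ≠ x j) →
        siteEnergy lennardJones x i ≤ ∑ j ∈ Finset.univ.erase i, lennardJones (dist y (x j))) →
      (N : ℝ) * eStar + g * (Nat.card {i : Fin N // ¬ IsTwoShellGood (1 / 20) (47 / 50) 1 x i} : ℝ)
        ≤ interactionEnergy lennardJones x :=
  Iff.rfl

/-- `1/3`-separated configurations are injective. [folklore] -/
theorem injective_of_third_sep {N : ℕ} {x : Fin N → E3}
    (h : ∀ i j : Fin N, i ≠ j → (1 / 3 : ℝ) ≤ dist (x i) (x j)) : Function.Injective x := by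
  intro i j hij
  by_contra hne
  have := h i j hne
  rw [hij, dist_self] at this
  linarith

/-- **The `g = 0` skeleton is free on the class** (indeed for every `1/3`-separated `x`, Nash or
not): `N·e* ≤ 𝓔(x)` (tree: periodisation + `BddBelow`).  All content of the crux is `0 < g`.
[folklore] -/
theorem nashGap_zero {N : ℕ} {x : Fin N → E3}
    (hx : ∀ i j : Fin N, i ≠ j → (1 / 3 : ℝ) ≤ dist (x i) (x j)) :
    (N : ℝ) * eStar ≤ interactionEnergy lennardJones x :=
  card_mul_eStar_le (injective_of_third_sep hx)

/-! ## §1 Unit-distance clusters are Nash: non-vacuity and the certified tightness of `g` -/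

/-- **A configuration with all mutual distances equal to `1` is Nash**: each site sum is
`−(N−1)/12`, and every hole potential is `≥ −(N−1)/12` termwise (`V_LJ ≥ −1/12`).  Singleton, unit
dimer, unit triangle and unit tetrahedron are the instances in `ℝ³`. [folklore] -/
theorem nash_of_forall_dist_eq_one {N : ℕ} {x : Fin N → E3}
    (h : ∀ i j : Fin N, i ≠ j → dist (x i) (x j) = 1) (i : Fin N) (y : E3) :
    siteEnergy lennardJones x i ≤ ∑ j ∈ Finset.univ.erase i, lennardJones (dist y (x j)) := by
  unfold siteEnergy
  refine Finset.sum_le_sum fun k hk => ?_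
  rw [h i k (Finset.ne_of_mem_erase hk).symm, lennardJones_one]
  exact neg_one_div_le_lennardJones _

/-- Site sums of an all-unit-distance configuration: `−(N−1)/12`. [folklore] -/
theorem siteEnergy_of_forall_dist_eq_one {N : ℕ} {x : Fin N → E3}
    (h : ∀ i j : Fin N, i ≠ j → dist (x i) (x j) = 1) (i : Fin N) :
    siteEnergy lennardJones x i = -(((N : ℝ) - 1) / 12) := by
  unfold siteEnergy
  rw [Finset.sum_congr rfl fun k hk => by
    rw [h i k (Finset.ne_of_mem_erase hk).symm, lennardJones_one]]
  rw [Finset.sum_const, Finset.card_erase_of_mem (Finset.mem_univ i), Finset.card_univ,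
    Fintype.card_fin, nsmul_eq_mul, Nat.cast_sub (Fin.pos i)]
  push_cast
  ring

/-- Energy of an all-unit-distance configuration: `−N(N−1)/24`. [folklore] -/
theorem interactionEnergy_of_forall_dist_eq_one {N : ℕ} {x : Fin N → E3}
    (h : ∀ i j : Fin N, i ≠ j → dist (x i) (x j) = 1) :
    interactionEnergy lennardJones x = -((N : ℝ) * ((N : ℝ) - 1) / 24) := by
  have h2 := two_mul_interactionEnergy lennardJones x
  rw [Finset.sum_congr rfl fun i _ => siteEnergy_of_forall_dist_eq_one h i, Finset.sum_const,
    Finset.card_univ, Fintype.card_fin, nsmul_eq_mul] at h2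
  linear_combination (1 / 2 : ℝ) * h2

/-- An all-unit-distance configuration is injective and `1/3`-separated. [folklore] -/
theorem third_le_dist_of_forall_dist_eq_one {N : ℕ} {x : Fin N → E3}
    (h : ∀ i j : Fin N, i ≠ j → dist (x i) (x j) = 1) :
    ∀ i j : Fin N, i ≠ j → (1 / 3 : ℝ) ≤ dist (x i) (x j) := fun i j hij => by
  rw [h i j hij]; norm_num

/-- **The regular unit tetrahedron exists in `ℝ³`** (alternate vertices of the cube of side `1/√2`).
[folklore] -/
theorem exists_unit_tetrahedron :
    ∃ x : Fin 4 → E3, ∀ i j : Fin 4, i ≠ j → dist (x i) (x j) = 1 := by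
  set s : ℝ := Real.sqrt (1 / 2) with hs
  have hs2 : s ^ 2 = 1 / 2 := Real.sq_sqrt (by norm_num)
  refine ⟨![!₂[0, 0, 0], !₂[s, s, 0], !₂[s, 0, s], !₂[0, s, s]], ?_⟩
  intro i j hij
  fin_cases i <;> fin_cases j <;>
    first
    | exact absurd rfl hij
    | (rw [EuclideanSpace.dist_eq, Real.sqrt_eq_one, Fin.sum_univ_three]
       simp [hs2]
       norm_num)

/-- **Tightness, one particle**: every admissible `g` has `g ≤ −e*` (the singleton is Nash, bad, and
has energy `0`). [folklore] -/
theorem g_le_neg_eStar_of_nashGap {g : ℝ}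
    (hG : ∀ (N : ℕ) (x : Fin N → E3),
      (∀ i j : Fin N, i ≠ j → (1 / 3 : ℝ) ≤ dist (x i) (x j)) →
      (∀ (i : Fin N) (y : E3), (∀ j : Fin N, j ≠ i → y ≠ x j) →
        siteEnergy lennardJones x i ≤ ∑ j ∈ Finset.univ.erase i, lennardJones (dist y (x j))) →
      (N : ℝ) * eStar + g * (Nat.card {i : Fin N // ¬ IsTwoShellGood (1 / 20) (47 / 50) 1 x i} : ℝ)
        ≤ interactionEnergy lennardJones x) :
    g ≤ -eStar := by
  have hd : ∀ i j : Fin 1, i ≠ j → dist ((fun _ => (0 : E3)) i) ((fun _ => (0 : E3)) j) = 1 :=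
    fun i j hij => absurd (Subsingleton.elim i j) hij
  have h1 := hG 1 (fun _ => 0) (third_le_dist_of_forall_dist_eq_one hd)
    (fun i y _ => nash_of_forall_dist_eq_one hd i y)
  rw [bad_eq_of_le (1 / 20) (N := 1) (by norm_num) (fun _ => 0), interactionEnergy_of_subsingleton]
    at h1
  push_cast at h1
  linarith

/-- **Tightness, the tetrahedron**: every admissible `g` has `g ≤ −1/8 − e*` (the regular unit
tetrahedron is `1`-separated, Nash, all-bad since `4 ≤ 18`, with energy `6·V_LJ(1) = −1/2`).  This is
the end of the certified road: a cluster with a non-unit distance needs a global Nash certificate, and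
a numerical value needs `e*` from below. [folklore] -/
theorem g_le_of_nashGap {g : ℝ}
    (hG : ∀ (N : ℕ) (x : Fin N → E3),
      (∀ i j : Fin N, i ≠ j → (1 / 3 : ℝ) ≤ dist (x i) (x j)) →
      (∀ (i : Fin N) (y : E3), (∀ j : Fin N, j ≠ i → y ≠ x j) →
        siteEnergy lennardJones x i ≤ ∑ j ∈ Finset.univ.erase i, lennardJones (dist y (x j))) →
      (N : ℝ) * eStar + g * (Nat.card {i : Fin N // ¬ IsTwoShellGood (1 / 20) (47 / 50) 1 x i} : ℝ)
        ≤ interactionEnergy lennardJones x) :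
    g ≤ -1 / 8 - eStar := by
  obtain ⟨x, hx⟩ := exists_unit_tetrahedron
  have h1 := hG 4 x (third_le_dist_of_forall_dist_eq_one hx) (fun i y _ => nash_of_forall_dist_eq_one hx i y)
  rw [bad_eq_of_le (1 / 20) (N := 4) (by norm_num) x, interactionEnergy_of_forall_dist_eq_one hx] at h1
  push_cast at h1
  linarith

/-- **`e* ≤ −1/8` unconditionally** (periodise the unit tetrahedron: `4·e* ≤ 𝓔 = −1/2`; improves the
tree's `−1/24` from the dimer). [folklore] -/
theorem eStar_le_neg_one_eighth : eStar ≤ -1 / 8 := by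
  obtain ⟨x, hx⟩ := exists_unit_tetrahedron
  have h1 := card_mul_eStar_le (injective_of_third_sep (third_le_dist_of_forall_dist_eq_one hx))
  rw [interactionEnergy_of_forall_dist_eq_one hx] at h1
  push_cast at h1
  linarith

/-- Hence the crux forces the strict inequality `e* < −1/8` (consistent, and numerically idle:
`e* ≈ −0.7176`). [folklore] -/
theorem eStar_lt_of_nashTwoShellGap (h : NashTwoShellGap) : eStar < -1 / 8 := by
  obtain ⟨g, hg, hG⟩ := h
  have := g_le_of_nashGap hG
  linarith

/-! ## §2 Separation is injectivity on the Nash class -/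

/-- **Nash + distinct points ⇒ `1/3`-separated** (the tree's closest-pair argument for ground
states, run with the removal inequality `siteEnergy ≤ 0` of the Nash class,
`siteEnergy_nonpos_of_nash`): at a closest pair at distance `r < 1/3`, `0 ≥ r⁻¹²/12 − (250/6)r⁻⁶`
contradicts `r⁻⁶ > 729`. [folklore] -/
theorem third_le_dist_of_nash {N : ℕ} {x : Fin N → E3} (hx : Function.Injective x)
    (hN : ∀ (i : Fin N) (y : E3), (∀ j : Fin N, j ≠ i → y ≠ x j) →
      siteEnergy lennardJones x i ≤ ∑ j ∈ Finset.univ.erase i, lennardJones (dist y (x j)))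
    {i j : Fin N} (hij : i ≠ j) : (1 / 3 : ℝ) ≤ dist (x i) (x j) := by
  by_contra hlt
  rw [not_le] at hlt
  obtain ⟨p, hp, hmin⟩ := Finset.exists_min_image Finset.univ.offDiag
    (fun p : Fin N × Fin N => dist (x p.1) (x p.2)) ⟨(i, j), by simp [hij]⟩
  obtain ⟨i₀, j₀⟩ := p
  have hij₀ : i₀ ≠ j₀ := by simpa using hp
  set r := dist (x i₀) (x j₀) with hr_def
  have hr : 0 < r := dist_pos.2 (hx.ne hij₀)
  have hsep : ∀ k l, k ≠ l → r ≤ dist (x k) (x l) := fun k l hkl => hmin (k, l) (by simp [hkl])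
  have hr3 : r < 1 / 3 := (hsep i j hij).trans_lt hlt
  have h0 := siteEnergy_nonpos_of_nash x i₀ (hN i₀)
  have hS := sum_inv_pow_six_le x hr hsep i₀
  have h12 : r⁻¹ ^ 12 ≤ ∑ k ∈ Finset.univ.erase i₀, (dist (x i₀) (x k))⁻¹ ^ 12 := by
    have hj : j₀ ∈ Finset.univ.erase i₀ := Finset.mem_erase.2 ⟨hij₀.symm, Finset.mem_univ _⟩
    exact Finset.single_le_sum (f := fun k => (dist (x i₀) (x k))⁻¹ ^ 12)
      (fun k _ => by positivity) hj
  have hexp : siteEnergy lennardJones x i₀ =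
      (1 / 12) * ∑ k ∈ Finset.univ.erase i₀, (dist (x i₀) (x k))⁻¹ ^ 12 -
        (1 / 6) * ∑ k ∈ Finset.univ.erase i₀, (dist (x i₀) (x k))⁻¹ ^ 6 := by
    simp only [siteEnergy, lennardJones, Finset.sum_sub_distrib, Finset.mul_sum]
  have hu : (729 : ℝ) < r⁻¹ ^ 6 := by
    have h3 : 3 < r⁻¹ := by
      rw [lt_inv_comm₀ (by norm_num) hr]
      have : (3 : ℝ)⁻¹ = 1 / 3 := by norm_num
      linarith
    calc (729 : ℝ) = 3 ^ 6 := by norm_num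
      _ < r⁻¹ ^ 6 := pow_lt_pow_left₀ h3 (by norm_num) (by norm_num)
  have h12' : r⁻¹ ^ 12 = (r⁻¹ ^ 6) ^ 2 := by ring
  have hu' : 729 * r⁻¹ ^ 6 < r⁻¹ ^ 6 * r⁻¹ ^ 6 := mul_lt_mul_of_pos_right hu (by linarith)
  rw [h12', sq] at h12
  linarith

/-- **The crux is equivalent to its injective form**: the hypothesis `1/3`-separated may be replaced
by `Function.Injective x` (same `g`).  So `h_sep` is exactly "distinct points"; what cannot be dropped
is injectivity, and only because of the junk value `V_LJ(0) = 0`. [folklore] -/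
theorem nashTwoShellGap_iff_injectiveForm :
    NashTwoShellGap ↔ ∃ g : ℝ, 0 < g ∧ ∀ (N : ℕ) (x : Fin N → E3), Function.Injective x →
      (∀ (i : Fin N) (y : E3), (∀ j : Fin N, j ≠ i → y ≠ x j) →
        siteEnergy lennardJones x i ≤ ∑ j ∈ Finset.univ.erase i, lennardJones (dist y (x j))) →
      (N : ℝ) * eStar + g * (Nat.card {i : Fin N // ¬ IsTwoShellGood (1 / 20) (47 / 50) 1 x i} : ℝ)
        ≤ interactionEnergy lennardJones x := by
  constructor
  · rintro ⟨g, hg, hG⟩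
    exact ⟨g, hg, fun N x hx hN => hG N x (fun i j hij => third_le_dist_of_nash hx hN hij) hN⟩
  · rintro ⟨g, hg, hG⟩
    exact ⟨g, hg, fun N x hsep hN => hG N x (injective_of_third_sep hsep) hN⟩

/-- **Every Lennard-Jones ground state lies in the class**: injective, Nash (the landed one-particle
move `siteEnergy_le_sum_of_isGroundState`) and therefore `1/3`-separated. [folklore] -/
theorem isGroundState_mem_class {N : ℕ} {x : Fin N → E3} (hx : IsGroundState lennardJones x) :
    Function.Injective x ∧
    (∀ (i : Fin N) (y : E3), (∀ j : Fin N, j ≠ i → y ≠ x j) →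
        siteEnergy lennardJones x i ≤ ∑ j ∈ Finset.univ.erase i, lennardJones (dist y (x j))) ∧
    (∀ i j : Fin N, i ≠ j → (1 / 3 : ℝ) ≤ dist (x i) (x j)) := by
  have hN : ∀ (i : Fin N) (y : E3), (∀ j : Fin N, j ≠ i → y ≠ x j) →
      siteEnergy lennardJones x i ≤ ∑ j ∈ Finset.univ.erase i, lennardJones (dist y (x j)) :=
    fun i y hy => siteEnergy_le_sum_of_isGroundState hx i hy
  exact ⟨hx.1, hN, fun i j hij => third_le_dist_of_nash hx.1 hN hij⟩

/-! ## §3 The kill template: nothing may charge ground states linearly -/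

/-- **No price charges ground states linearly.**  If a count `B` satisfies `B(x) ≥ c·N` on ground
states of arbitrarily large size (`c > 0`), then `N·e* + g·B(x) ≤ 𝓔(x)` fails on some ground state
for every `g > 0` — because `𝓔(x_N) = E(N)` and `E(N)/N → e*` (tree).  No knowledge of the value of
`e*` is needed; this is the only `e*`-free refutation mechanism available for this crux. [folklore] -/
theorem false_of_linear_charge_on_groundStates {g c : ℝ} (hg : 0 < g) (hc : 0 < c)
    (B : (N : ℕ) → (Fin N → E3) → ℝ)
    (hB : ∀ N₀ : ℕ, ∃ N : ℕ, N₀ ≤ N ∧ ∃ x : Fin N → E3, IsGroundState lennardJones x ∧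
      c * N ≤ B N x)
    (hG : ∀ (N : ℕ) (x : Fin N → E3), IsGroundState lennardJones x →
      (N : ℝ) * eStar + g * B N x ≤ interactionEnergy lennardJones x) : False := by
  have hlim : Filter.Tendsto (fun N : ℕ => groundStateEnergy lennardJones 3 N / N) Filter.atTop
      (nhds eStar) := crysEnergyLimit
  have hev : ∀ᶠ N : ℕ in Filter.atTop, groundStateEnergy lennardJones 3 N / N < eStar + g * c :=
    hlim.eventually (gt_mem_nhds (by nlinarith))
  obtain ⟨N₀, hN₀⟩ := Filter.eventually_atTop.1 (hev.and (Filter.eventually_ge_atTop 1))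
  obtain ⟨N, hNN₀, x, hx, hcN⟩ := hB N₀
  obtain ⟨hlt, hN1⟩ := hN₀ N hNN₀
  have hNr : (0 : ℝ) < N := by exact_mod_cast hN1
  have h1 := hG N x hx
  rw [hx.2] at h1
  rw [div_lt_iff₀ hNr] at hlt
  nlinarith

/-- **KILL TEMPLATE.**  If along a subsequence the Lennard-Jones ground states carry a positive
fraction of `1/20`-bad particles, the crux is false (whatever `e*` is).  A refutation by an explicit
non-minimising Nash family would in addition have to certify `e*` from below to the precision of the
family's excess per particle — impossible with the tree's bounds — so this template is, today, the
only road to `¬ NashTwoShellGap`; its hypothesis is the failure of two-shell crystallization of ground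
states, which nobody can exhibit either.  This is why the crux resists disproof. [folklore] -/
theorem not_nashTwoShellGap_of_groundStates_bad
    (hbad : ∃ c : ℝ, 0 < c ∧ ∀ N₀ : ℕ, ∃ N : ℕ, N₀ ≤ N ∧ ∃ x : Fin N → E3,
      IsGroundState lennardJones x ∧
      c * N ≤ (Nat.card {i : Fin N // ¬ IsTwoShellGood (1 / 20) (47 / 50) 1 x i} : ℝ)) :
    ¬ NashTwoShellGap := by
  rintro ⟨g, hg, hG⟩
  obtain ⟨c, hc, hfreq⟩ := hbad
  refine false_of_linear_charge_on_groundStates hg hc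
    (fun N x => (Nat.card {i : Fin N // ¬ IsTwoShellGood (1 / 20) (47 / 50) 1 x i} : ℝ)) hfreq
    fun N x hx => ?_
  obtain ⟨-, hN, hsep⟩ := isGroundState_mem_class hx
  exact hG N x hsep hN

/-- **Contrapositive, for the provers**: the crux PREDICTS that ground states have `o(N)` bad
particles — for every `c > 0`, eventually in `N`, every ground state has `< c·N` bad particles.  This
(and only this) is what `NashHullBridge`/`closes` extract from the crux. [folklore] -/
theorem bad_lt_of_nashTwoShellGap (h : NashTwoShellGap) {c : ℝ} (hc : 0 < c) :
    ∃ N₀ : ℕ, ∀ N : ℕ, N₀ ≤ N → ∀ x : Fin N → E3, IsGroundState lennardJones x →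
      (Nat.card {i : Fin N // ¬ IsTwoShellGood (1 / 20) (47 / 50) 1 x i} : ℝ) < c * N := by
  by_contra hcon
  push Not at hcon
  exact not_nashTwoShellGap_of_groundStates_bad ⟨c, hc, hcon⟩ h

/-- At a negative tolerance nobody is good (a match within `ε·a < 0` is impossible). [folklore] -/
theorem not_isTwoShellGood_of_neg {ε aLo aHi : ℝ} (hε : ε < 0) (haLo : 0 < aLo) {N : ℕ}
    (x : Fin N → E3) (i : Fin N) : ¬ IsTwoShellGood ε aLo aHi x i := by
  rintro ⟨a, ha₁, -, A, P, f, hP, hf, -, -⟩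
  have hcard : P.card = 18 := card_eq_eighteen_of_twoShellPattern hP
  obtain ⟨v, hv⟩ : P.Nonempty := Finset.card_pos.1 (by omega)
  have h1 := (hf v hv).2
  have h2 : ε * a < 0 := mul_neg_of_neg_of_pos hε (haLo.trans_le ha₁)
  linarith [dist_nonneg (x := x (f v)) (y := x i + a • A v)]

/-- **The admissible tolerances form an up-set** (the crux is the `ε = 1/20` member of the family,
verbatim). [folklore] -/
theorem tol_mono {ε ε' : ℝ} (hε : ε ≤ ε')
    (h : ∃ g : ℝ, 0 < g ∧ ∀ (N : ℕ) (x : Fin N → E3),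
      (∀ i j : Fin N, i ≠ j → (1 / 3 : ℝ) ≤ dist (x i) (x j)) →
      (∀ (i : Fin N) (y : E3), (∀ j : Fin N, j ≠ i → y ≠ x j) →
        siteEnergy lennardJones x i ≤ ∑ j ∈ Finset.univ.erase i, lennardJones (dist y (x j))) →
      (N : ℝ) * eStar + g * (Nat.card {i : Fin N // ¬ IsTwoShellGood ε (47 / 50) 1 x i} : ℝ)
        ≤ interactionEnergy lennardJones x) :
    ∃ g : ℝ, 0 < g ∧ ∀ (N : ℕ) (x : Fin N → E3),
      (∀ i j : Fin N, i ≠ j → (1 / 3 : ℝ) ≤ dist (x i) (x j)) →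
      (∀ (i : Fin N) (y : E3), (∀ j : Fin N, j ≠ i → y ≠ x j) →
        siteEnergy lennardJones x i ≤ ∑ j ∈ Finset.univ.erase i, lennardJones (dist y (x j))) →
      (N : ℝ) * eStar + g * (Nat.card {i : Fin N // ¬ IsTwoShellGood ε' (47 / 50) 1 x i} : ℝ)
        ≤ interactionEnergy lennardJones x := by
  obtain ⟨g, hg, hG⟩ := h
  refine ⟨g, hg, fun N x hsep hN => le_trans ?_ (hG N x hsep hN)⟩
  have : (Nat.card {i : Fin N // ¬ IsTwoShellGood ε' (47 / 50) 1 x i} : ℝ) ≤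
      Nat.card {i : Fin N // ¬ IsTwoShellGood ε (47 / 50) 1 x i} := by exact_mod_cast bad_anti hε x
  nlinarith

/-- **The tolerance sign is load-bearing**: with `ε < 0` in place of `1/20` the statement is false on
the Nash class (every ground state is all-bad and `E(N)/N → e*`).  The boundary case `ε = 0`, refuted
for the parent crux 13956 by generic perturbation, is OPEN on the Nash class. [folklore] -/
theorem not_tol_of_neg {ε : ℝ} (hε : ε < 0) :
    ¬ ∃ g : ℝ, 0 < g ∧ ∀ (N : ℕ) (x : Fin N → E3),
      (∀ i j : Fin N, i ≠ j → (1 / 3 : ℝ) ≤ dist (x i) (x j)) →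
      (∀ (i : Fin N) (y : E3), (∀ j : Fin N, j ≠ i → y ≠ x j) →
        siteEnergy lennardJones x i ≤ ∑ j ∈ Finset.univ.erase i, lennardJones (dist y (x j))) →
      (N : ℝ) * eStar + g * (Nat.card {i : Fin N // ¬ IsTwoShellGood ε (47 / 50) 1 x i} : ℝ)
        ≤ interactionEnergy lennardJones x := by
  rintro ⟨g, hg, hG⟩
  refine false_of_linear_charge_on_groundStates hg one_pos
    (fun N x => (Nat.card {i : Fin N // ¬ IsTwoShellGood ε (47 / 50) 1 x i} : ℝ))
    (fun N₀ => ⟨N₀, le_rfl, ?_⟩) fun N x hx => ?_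
  · obtain ⟨x, hx⟩ := LennardJonesGroundStatesExist_holds N₀
    refine ⟨x, hx, ?_⟩
    rw [bad_eq_of_forall ε fun i => not_isTwoShellGood_of_neg hε (by norm_num) x i, one_mul]
  · obtain ⟨-, hN, hsep⟩ := isGroundState_mem_class hx
    exact hG N x hsep hN

/-! ## §4 The picked line `birth` is a partition of the crux -/

/-- **The exposed-bad gap of line `birth` follows from the crux** (sub-count, and `1/2`-separated ⊂
`1/3`-separated); with `NashTwoShellGapReductions.jammedBadGap_of_nashTwoShellGap` both gap stubs are
consequences of the crux, so neither is refutable short of refuting the crux. [folklore] -/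
theorem exposedBadGap_of_nashTwoShellGap (h : NashTwoShellGap) :
    ∃ g : ℝ, 0 < g ∧ ∀ (N : ℕ) (x : Fin N → E3),
      (∀ i j : Fin N, i ≠ j → (1 / 2 : ℝ) ≤ dist (x i) (x j)) →
      (∀ (i : Fin N) (y : E3), (∀ j : Fin N, j ≠ i → y ≠ x j) →
        siteEnergy lennardJones x i ≤ ∑ j ∈ Finset.univ.erase i, lennardJones (dist y (x j))) →
      (N : ℝ) * eStar + g * (Nat.card {i : Fin N // ¬ IsTwoShellGood (1 / 20) (47 / 50) 1 x i ∧
          ∃ p : E3, dist p (x i) ≤ 6 / 5 ∧ ∀ j : Fin N, 9 / 10 ≤ dist p (x j)} : ℝ)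
        ≤ interactionEnergy lennardJones x := by
  obtain ⟨g, hg, hG⟩ := nashTwoShellGap_iff.1 h
  refine ⟨g, hg, fun N x hsep hN => le_trans ?_ (hG N x (fun i j hij => ?_) hN)⟩
  · have hle : Nat.card {i : Fin N // ¬ IsTwoShellGood (1 / 20) (47 / 50) 1 x i ∧
          ∃ p : E3, dist p (x i) ≤ 6 / 5 ∧ ∀ j : Fin N, 9 / 10 ≤ dist p (x j)} ≤
        Nat.card {i : Fin N // ¬ IsTwoShellGood (1 / 20) (47 / 50) 1 x i} :=
      Nat.card_mono (Set.toFinite _) fun i hi => hi.1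
    have : (Nat.card {i : Fin N // ¬ IsTwoShellGood (1 / 20) (47 / 50) 1 x i ∧
          ∃ p : E3, dist p (x i) ≤ 6 / 5 ∧ ∀ j : Fin N, 9 / 10 ≤ dist p (x j)} : ℝ) ≤
        Nat.card {i : Fin N // ¬ IsTwoShellGood (1 / 20) (47 / 50) 1 x i} := by exact_mod_cast hle
    nlinarith
  · linarith [hsep i j hij]

/-! ## §1bis Certified reach of a refutation -/

/-- **`e* ≥ −2³²/12`** — the ONLY lower bound on `e*` available in the tree (Fisher–Ruelle stability
constant, `neg_mul_le_groundStateEnergy_lennardJones`, through `E(N)/N → e*`). [folklore] -/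
theorem neg_stability_le_eStar : -((65536 : ℝ) ^ 2 / 12) ≤ eStar := by
  have hlim : Filter.Tendsto (fun N : ℕ => groundStateEnergy lennardJones 3 N / N) Filter.atTop
      (nhds eStar) := crysEnergyLimit
  refine ge_of_tendsto hlim (Filter.eventually_atTop.2 ⟨1, fun N hN => ?_⟩)
  have hNr : (0 : ℝ) < N := by exact_mod_cast hN
  rw [le_div_iff₀ hNr]
  have := neg_mul_le_groundStateEnergy_lennardJones (by norm_num : 3 ≤ 5) N
  linarith

/-- **What IS refutable today: astronomically large prices only.**  `GapAt g` fails for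
`g > 2³²/12 − 1/8` (tetrahedron bound + stability constant) — and for no smaller `g` by any argument
in this file; the believed optimum is `g_opt ≈ 4·10⁻³`.  The gulf of eleven orders of magnitude is
exactly the missing Kepler-type lower bound on periodic Lennard-Jones energies. [folklore] -/
theorem not_nashGap_of_huge {g : ℝ} (hg : (65536 : ℝ) ^ 2 / 12 - 1 / 8 < g) :
    ¬ ∀ (N : ℕ) (x : Fin N → E3),
      (∀ i j : Fin N, i ≠ j → (1 / 3 : ℝ) ≤ dist (x i) (x j)) →
      (∀ (i : Fin N) (y : E3), (∀ j : Fin N, j ≠ i → y ≠ x j) →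
        siteEnergy lennardJones x i ≤ ∑ j ∈ Finset.univ.erase i, lennardJones (dist y (x j))) →
      (N : ℝ) * eStar + g * (Nat.card {i : Fin N // ¬ IsTwoShellGood (1 / 20) (47 / 50) 1 x i} : ℝ)
        ≤ interactionEnergy lennardJones x := fun hG => by
  have h1 := g_le_of_nashGap hG
  have h2 := neg_stability_le_eStar
  linarith

/-- **A violator is a near-minimiser with dense badness**: if an injective `x` violates the price `g`,
then `0 ≤ 𝓔(x) − N·e* < g·#bad(x) ≤ g·N`.  Certifying an explicit violator therefore needs `e*` FROM
BELOW to precision `g·#bad/N`. [folklore] -/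
theorem violation_squeeze {g : ℝ} {N : ℕ} {x : Fin N → E3} (hx : Function.Injective x)
    (hlt : interactionEnergy lennardJones x <
      (N : ℝ) * eStar + g * (Nat.card {i : Fin N // ¬ IsTwoShellGood (1 / 20) (47 / 50) 1 x i} : ℝ)) :
    0 ≤ interactionEnergy lennardJones x - (N : ℝ) * eStar ∧
      interactionEnergy lennardJones x - (N : ℝ) * eStar <
        g * (Nat.card {i : Fin N // ¬ IsTwoShellGood (1 / 20) (47 / 50) 1 x i} : ℝ) ∧
      (Nat.card {i : Fin N // ¬ IsTwoShellGood (1 / 20) (47 / 50) 1 x i} : ℝ) ≤ N :=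
  ⟨by linarith [card_mul_eStar_le hx], by linarith, by exact_mod_cast bad_le _ x⟩

/-! ## §5 NEAR-MISS: injectivity dropped (junk `V_LJ(0) = 0`) -/

/-- Index type of the pile cluster: `3m` centre twins ⊕ (`12` cuboctahedron vertices × `m` twins). -/
abbrev PileIdx (m : ℕ) : Type := Fin (3 * m) ⊕ (↥fccKissingPattern × Fin m)

/-- The pile cluster on its natural index type: centre twins at `0`, vertex twins at the vertex. -/
def pileOn (m : ℕ) : PileIdx m → E3 := Sum.elim (fun _ => 0) (fun p => (p.1 : E3))

/-- The pile cluster as a `Fin N`-indexed configuration, `N = 15m`. -/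
def cuboPile (m : ℕ) : Fin (Fintype.card (PileIdx m)) → E3 :=
  pileOn m ∘ (Fintype.equivFin (PileIdx m)).symm

theorem card_pileIdx (m : ℕ) : Fintype.card (PileIdx m) = 15 * m := by
  simp only [PileIdx, Fintype.card_sum, Fintype.card_prod, Fintype.card_fin, Fintype.card_coe,
    card_fccKissingPattern]
  ring

/-- **`2·𝓔(cuboPile m) ≤ −6m²`**: the `2·3m·12m` (ordered) centre–vertex pairs sit at distance `1`
(`V = −1/12`); centre twins and vertex twins are coincident (`V(0) = 0`, junk); distinct vertices are
`≥ 1` apart (`V ≤ 0`, tree facts on `fccKissingPattern`). [folklore] -/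
theorem two_mul_interactionEnergy_cuboPile_le (m : ℕ) :
    2 * interactionEnergy lennardJones (cuboPile m) ≤ -(6 * (m : ℝ) ^ 2) := by
  rw [two_mul_interactionEnergy_eq_sum_sum lennardJones lennardJones_zero]
  have hre : ∑ i, ∑ k, lennardJones (dist (cuboPile m i) (cuboPile m k)) =
      ∑ a : PileIdx m, ∑ b : PileIdx m, lennardJones (dist (pileOn m a) (pileOn m b)) := by
    unfold cuboPile
    simp only [Function.comp]
    exact Fintype.sum_equiv (Fintype.equivFin (PileIdx m)).symm _ _ fun i =>
      Fintype.sum_equiv (Fintype.equivFin (PileIdx m)).symm _ _ fun k => rfl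
  rw [hre, Fintype.sum_sum_type]
  simp only [Fintype.sum_sum_type, pileOn, Sum.elim_inl, Sum.elim_inr, dist_self, lennardJones_zero,
    Finset.sum_const_zero, zero_add]
  -- centre–vertex blocks
  have hcv : ∀ p : ↥fccKissingPattern × Fin m, lennardJones (dist (0 : E3) (p.1 : E3)) = -1 / 12 := by
    intro p
    rw [dist_comm, dist_zero_right, norm_eq_one_of_mem_fccKissingPattern p.1.2, lennardJones_one]
  have hvc : ∀ p : ↥fccKissingPattern × Fin m, lennardJones (dist (p.1 : E3) (0 : E3)) = -1 / 12 := by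
    intro p
    rw [dist_zero_right, norm_eq_one_of_mem_fccKissingPattern p.1.2, lennardJones_one]
  have hvv : ∀ p q : ↥fccKissingPattern × Fin m, lennardJones (dist (p.1 : E3) (q.1 : E3)) ≤ 0 := by
    intro p q
    by_cases h : (p.1 : E3) = q.1
    · rw [h, dist_self, lennardJones_zero]
    · exact lennardJones_nonpos (one_le_dist_of_mem_fccKissingPattern p.1.2 q.1.2 h)
  have hcard : (Finset.univ : Finset (↥fccKissingPattern × Fin m)).card = 12 * m := by
    rw [Finset.card_univ, Fintype.card_prod, Fintype.card_fin, Fintype.card_coe, card_fccKissingPattern]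
  simp only [hcv, hvc, Finset.sum_const, hcard, Finset.card_univ, Fintype.card_fin, nsmul_eq_mul]
  have h3 : ∑ p : ↥fccKissingPattern × Fin m, ∑ q : ↥fccKissingPattern × Fin m,
      lennardJones (dist (p.1 : E3) (q.1 : E3)) ≤ 0 :=
    Finset.sum_nonpos fun p _ => Finset.sum_nonpos fun q _ => hvv p q
  rw [Finset.sum_add_distrib, Finset.sum_const, hcard, nsmul_eq_mul]
  push_cast
  nlinarith [h3]


/-- **Injectivity is load-bearing, modulo the junk-Nash certificate of the piles.**  If the pile
clusters `cuboPile m` (`m ≥ 2`) are Nash in Lean's junk sense (numerically certified, kit j026014;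
NOT a Lean fact), then the injectivity-free (= separation-free, §2) form of the crux is false for
every `g > 0`: `N = 15m`, `𝓔 ≤ −3m²` against `N·e* + g·#bad ≥ 15m·e*`, violated once `m > 5|e*|`
— no value of `e*` needed. [folklore] -/
theorem nashTwoShellGap_false_without_injective_of_pileNash
    (hNash : ∀ m : ℕ, 2 ≤ m → ∀ (i : Fin (Fintype.card (PileIdx m))) (y : E3),
      (∀ j : Fin (Fintype.card (PileIdx m)), j ≠ i → y ≠ cuboPile m j) →
      siteEnergy lennardJones (cuboPile m) i ≤
        ∑ j ∈ Finset.univ.erase i, lennardJones (dist y (cuboPile m j))) :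
    ¬ ∃ g : ℝ, 0 < g ∧ ∀ (N : ℕ) (x : Fin N → E3),
      (∀ (i : Fin N) (y : E3), (∀ j : Fin N, j ≠ i → y ≠ x j) →
        siteEnergy lennardJones x i ≤ ∑ j ∈ Finset.univ.erase i, lennardJones (dist y (x j))) →
      (N : ℝ) * eStar + g * (Nat.card {i : Fin N // ¬ IsTwoShellGood (1 / 20) (47 / 50) 1 x i} : ℝ)
        ≤ interactionEnergy lennardJones x := by
  rintro ⟨g, hg, hG⟩
  obtain ⟨m₀, hm₀⟩ := exists_nat_gt (5 * |eStar|)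
  set m : ℕ := m₀ + 2 with hm
  have hm2 : 2 ≤ m := by omega
  have hmr : 5 * |eStar| < m := by
    have : (m₀ : ℝ) ≤ m := by simp [hm]
    linarith
  have hmpos : (0 : ℝ) < m := by positivity
  have h := hG _ (cuboPile m) (hNash m hm2)
  have hN : ((Fintype.card (PileIdx m) : ℕ) : ℝ) = 15 * (m : ℝ) := by
    rw [card_pileIdx]; push_cast; ring
  rw [hN] at h
  have hE := two_mul_interactionEnergy_cuboPile_le m
  have hb : (0 : ℝ) ≤ g * (Nat.card {i : Fin (Fintype.card (PileIdx m)) //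
      ¬ IsTwoShellGood (1 / 20) (47 / 50) 1 (cuboPile m) i} : ℝ) :=
    mul_nonneg hg.le (Nat.cast_nonneg _)
  have h4 : 15 * (m : ℝ) * eStar ≤ -(3 * (m : ℝ) ^ 2) := by linarith
  have h6 : 15 * (m : ℝ) * -|eStar| ≤ 15 * (m : ℝ) * eStar :=
    mul_le_mul_of_nonneg_left (neg_abs_le eStar) (by positivity)
  have h7 : 5 * |eStar| * (m : ℝ) < (m : ℝ) * m := mul_lt_mul_of_pos_right hmr hmpos
  nlinarith


/-- **NEAR-MISS (the one `sorry` of this work file).**  With the separation hypothesis dropped — by §2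
equivalently: with INJECTIVITY dropped — the statement is false for every `g > 0`, through Lean's junk
value `V_LJ(0) = 0` for coincident particles.

WITNESS (pile cluster).  Sites: the centre `0` and the `12` cuboctahedron vertices `w` (`|w| = 1`,
nearest-neighbour distance `1`, other distances `√2, √3, 2`).  Put `n = 3m` coincident particles at the
centre and `m` coincident particles at each vertex (`m ≥ 2`), `N = 15m`.
* ENERGY: coincident pairs contribute `V(0) = 0`; the `36m²` centre–vertex pairs contribute `−1/12`
  each; all vertex–vertex pairs have distance `≥ 1`, hence `V ≤ 0`.  So `𝓔 ≤ −3m²`, quadratic in `N`,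
  against a left side `≥ N·e*` linear in `N`: violated for `m > 5|e*|` whatever `g ≥ 0` and `#bad` are.
* NASH (junk sense).  For a particle at site `s` with multiplicity `n_s` the best-response margin is
  `Ψ_s(y) = (n_s − 1)V(|y − p_s|) + Σ_{t ≠ s} n_t [V(|y − p_t|) − V(|p_s − p_t|)]`; at `p_s` the twins are
  free (`V(0) = 0`) but at any `y ≠ p_s` they repel/attract, with `V ≥ −1/12`.  CENTRE particles:
  `S = −3m·… = −m·12/12`; every point of the unit sphere is within `0.765` of a vertex pile
  (`V(0.765) ≈ +1.24` per particle), the best hole is the square cap at `√2` (`≈ −0.38m` against `−m`).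
  VERTEX particles: `S_v = −(3m)/12 − 0.399m`; the circle `{|y| = 1, |y − v| = 1}` (where the centre
  bond and the twin bonus `(m−1)/12` would both be collected) passes through the four common neighbours
  and stays within `0.8` of a vertex pile; best hole = square cap adjacent to `v`:
  `−(4m−1)/12 − 0.0195·3m − 0.03m ≈ −0.42m + 0.083` against `S_v ≈ −0.649m`.  Margin `≈ 0.23m`.
  CERTIFICATION (kit job j026014, 77 s, evidence `numerics-j026014.md`): interval branch-and-bound over
  `y ∈ [−3.2, 3.2]³` (outside: all distances `≥ 2.2`, analytic bound `> 0.46`) in floating point,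
  uniform in `m ≥ 2` (own-pile coefficient bounded by cases on the sign of `V`): CERTIFIED for every
  centre weight `λ = n/m ∈ {1, 1.5, 2, 3, 5, 8, 10, 12, 15}`, both particle classes, `≤ 2367` boxes each;
  margins `min_y Ψ/m` (121³ grid): vertex `0.100 (λ=1) … 0.225 (λ=3, the Lean witness) … 0.935 (λ=15)`,
  centre `0.617 … 0.575 … 0.285`.  Also certified: the rattack seat's `k`-pile on the LJ₆ octahedron
  (edge `0.9955`), margin `0.085·k` for all `k ≥ 2` (`k = 1`, injective, has margin exactly `0` at the
  own site, as it must).  NOT certified in Lean (needs a verified interval evaluator; `native_decide`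
  scale) — this is the ONLY `sorry` of the file, isolated as the hypothesis of
  `nashTwoShellGap_false_without_injective_of_pileNash` (everything else about the witness — index type,
  cardinality `15m`, energy `≤ −3m²`, the contradiction — is kernel-checked above).
WHY IT MATTERS (little): injectivity is all that `h_sep` contributes (§2) and cannot itself be dropped;
a junk-model effect, not physics.  Provers lose nothing. -/
theorem nashTwoShellGap_false_without_injective :
    ¬ ∃ g : ℝ, 0 < g ∧ ∀ (N : ℕ) (x : Fin N → E3),
      (∀ (i : Fin N) (y : E3), (∀ j : Fin N, j ≠ i → y ≠ x j) →
        siteEnergy lennardJones x i ≤ ∑ j ∈ Finset.univ.erase i, lennardJones (dist y (x j))) →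
      (N : ℝ) * eStar + g * (Nat.card {i : Fin N // ¬ IsTwoShellGood (1 / 20) (47 / 50) 1 x i} : ℝ)
        ≤ interactionEnergy lennardJones x :=
  nashTwoShellGap_false_without_injective_of_pileNash (by sorry)

/-! ## §6 Numerics ledger (uncertified) and the targets of line `birth`

TARGETS (`payload.targets` empty at cycle 1; the lead's stubs, for the record):
* `stub_nashSeparation` (1/3-sep ∧ Nash ⇒ 1/2-sep): TRUE, landed p158426.  Physical fixed point of the
  bootstrap `≈ 0.75–0.8`; not attackable.
* `stub_nashForceBalance` (Nash ⇒ `Σ_{j≠i}(r⁻⁸ − r⁻¹⁴)(x_i − x_j) = 0`): TRUE (Fermat on the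
  relocation energy; free points exist by separation).  Not attackable.
* `stub_exposedBadGap`, `stub_jammedBadGap`: consequences of the crux (§4), jointly equivalent to it
  (`NashTwoShellGap_of`); individually: exposed = under-coordinated (a `9/10`-hole within `6/5` forces a
  free cone of half-angle `47.6°` in the first shell, impossible with `12` touching neighbours by the
  cap-area count `12·(1 − cos 30°)/2 = 0.80 > 0.61`), priced by missing bonds `≳ 0.04` per particle —
  plausible with `g_S ~ 10⁻²`; jammed = the frustration/strain class = the crux's core.  No stub-level
  witness exists that is not a crux-level witness.

NUMERICS LEDGER for `g` on the Nash class (uncertified; sources: kit j023240 of the rattack seat,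
`BarrierNotesIdeator1/2.md`, `NumericsIdeator2.md`, this seat's estimates):
* singleton `0.72`, dimer `0.68`, tetrahedron `0.59` (certified shapes `−e*`, `−1/24 − e*`, `−1/8 − e*`);
* LJ₁₃ icosahedron `0.43`; Mackay icosahedra `N = 55…923`: Nash (margin `0.19–0.25`), bad fraction
  `→ 0.5`, implied `g ≤ 0.23`; fcc cuboctahedra / truncated octahedra: Nash (margin `0.13–0.22`),
  bad = surface, implied `g ≤ 0.23–0.29`;
* bulk competitors (all-bad interiors): bcc `+4.3 %` of `|e*|` ≈ `0.031` per particle (single-site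
  Nash-stable although Born-unstable), A15 `+12 %`, LJ glasses `+5–10 %`, vacancy `0.66/18 = 0.036`
  (but NOT Nash: a surface atom fills it), grain boundaries `0.03–0.06`;
* cheapest known Nash-compatible bad population: closed bent rings/tori of good crystal with half the
  particles just past the `1/20` misfit, Cauchy–Born price `2.3–2.9·10⁻³` at the threshold, optimised
  profile `≈ 2.25·κ·ε_c² ≈ 5·10⁻³` per bad particle ⇒ `g_opt ≈ 4–5·10⁻³ ≈ 0.6 %·|e*|` (ideator 2, B5);
  on the full class (13956) the rattler gives `1.8·10⁻³` — Nash buys a factor `≈ 2–3`, not `10`.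
* NO family with excess per bad particle `→ 0` is known: the threshold misfit `1/20` costs `κ(1/20)² > 0`
  from an unstrained reference whose own misfit is `~10⁻⁴–10⁻³` (relaxed hcp `c/a`), and every
  non-layered bulk structure sits `≥ 1 %` above hcp.  A refutation needs a non-Barlow Nash bulk phase
  degenerate with hcp to `< g·(bad fraction)` — none in print for the `6–12` potential.
-/

end Summit.AtomisticToContinuum.Crystallization.Cruxes.NashTwoShellGap.Disproof

end
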